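import Literature.Analysis.FunctionSpaces.LittlewoodPaleyOffDiagonal
import Mathlib.MeasureTheory.Function.LpSeminorm.CompareExp
import HarnessLib

/-!
# Local frequency splitting: `‖f‖_{L²(B₁(x₀))}` through `Ṡ_N` of its distribution

Analysis/FunctionSpaces proof file (theorems only: no definition, no named fact). The **local**
form of the frequency splitting behind W. Wang, Z. Zhang, Sci. China Math. 60 (2017) =
arXiv:1510.02589, **Lemma 3.2** (`‖u‖_{L²(B₁(x₀))} ≤ C ‖u‖^θ_{Ḃ^{-1+3/p}_{p,∞}} ‖u‖^{1-θ}_{H¹(B₂(x₀))}`,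
proved there after the global reduction "`‖φu‖_{Ḃ} ≤ C(φ)‖u‖_{Ḃ}`, so we may assume
`u ∈ H¹(ℝ³)`"), in a form that avoids the multiplier bound on `Ḃ`: for a locally integrable `f`
with tempered distribution `T`, a localisation `f₁` of `f` (any locally integrable `f₁` agreeing
with `f` on `B_{3/2}(x₀)`, e.g. `ψ f`) with distribution `T₁`, `2 ≤ p`, `N ∈ ℤ`, `m ∈ ℕ`:

  `‖f‖_{L²(B₁(x₀))} ≤ |B₁|^{1/2-1/p} ‖Ṡ_N T‖_{L^p} + ‖T₁ - Ṡ_N T₁‖_{L²}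
                      + |B₁|^{1/2} 2^{N(d-m)} p_{m,0}(𝓕Ψ₀) A`

(`eLpNorm_restrict_ball_le_of_lowFreqCutoff`), where `A` bounds the off-diagonal tails
`∫_{|y-a| ≥ 1/2} |y-a|^{-m} ‖f₁(y) - f(y)‖ dy`, `a ∈ B₁(x₀)` (finite for `m > d` and uniformly
locally integrable `f`, `f₁`). On `B₁(x₀)`, `f = Ṡ_N T + (f₁ - Ṡ_N T₁) + Ṡ_N (T₁ - T)` pointwise
(through the continuous representatives `a ↦ ⟨T, (𝓕Ψ_N)(· - a)⟩` of `BesovFatou.lean`), and the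
three terms are estimated by Hölder on the ball, by nothing, and by the off-diagonal decay of `Ṡ_N`
(`enorm_lowFreqCutoff_value_le_of_eqOn_ball`, the representing function `f₁ - f` of `T₁ - T`
vanishing on `B_{3/2}(x₀) ⊃ B_{1/2}(a)`). The first two terms are then bounded by
`‖Ṡ_N T‖_{L^p} ≲ 2^{-(N+1)s} ‖T‖_{Ḃ^s_{p,∞}}` (`eLpNormDistrib_lowFreqCutoff_le_of_neg`) and
`‖T₁ - Ṡ_N T₁‖_{L²} ≲ 2^{-N} ‖∇T₁‖_{L²}` (`FluidPDE/BesovHighFrequencyTail.lean`), which is how the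
inequality is consumed in the far-field step of §4 Step 1 of that paper.

Also recorded: `eLpNormDistrib_eq_eLpNorm_of_forall_apply_eq` — the `L^p` norm (in `[0, ∞]`) of a
distribution represented by a locally integrable function is the `L^p` norm of the function.

## References

* W. Wang, Z. Zhang, Sci. China Math. 60 (2017) 637–650 = arXiv:1510.02589, Lemma 3.2, §4 Step 1.
  [WangZhang2016]
* H. Bahouri, J.-Y. Chemin, R. Danchin, *Fourier Analysis and Nonlinear PDE* (2011), §2.1,
  Lemma 2.1. [BahouriCheminDanchin2011]
-/

noncomputable section

open MeasureTheory TemperedDistribution Filter Set Function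
open _root_.Topology _root_.FourierTransform
open scoped SchwartzMap ENNReal NNReal

namespace Literature.Analysis.FunctionSpaces

variable {E : Type*} [NormedAddCommGroup E] [InnerProductSpace ℝ E] [FiniteDimensional ℝ E]
  [MeasurableSpace E] [BorelSpace E] {F : Type*} [NormedAddCommGroup F] [NormedSpace ℂ F]
  [CompleteSpace F]

/-! ## `L^p` norms of represented distributions -/

/-- **The `L^p` norm of a distribution represented by a locally integrable function is the `L^p`
norm of the function** (in `[0, ∞]`; `1 ≤ p ≤ ∞`): if `⟨T, θ⟩ = ∫ θ • g` for all Schwartz `θ`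
with `g` locally integrable, then `‖T‖_{L^p} = ‖g‖_{L^p}` (if `g ∈ L^p` its class realises `T`;
if an `L^p` class realises `T` it has the same pairings with compactly supported smooth functions
as `g`, hence equals `g` a.e., Mathlib's `ae_eq_of_integral_contDiff_smul_eq`). [folklore] -/
theorem eLpNormDistrib_eq_eLpNorm_of_forall_apply_eq (p : ℝ≥0∞) [Fact (1 ≤ p)] {T : 𝓢'(E, F)}
    {g : E → F} (hg : LocallyIntegrable g volume)
    (hT : ∀ θ : 𝓢(E, ℂ), T θ = ∫ y, θ y • g y) :
    eLpNormDistrib p T = eLpNorm g p volume := by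
  by_cases hfin : eLpNorm g p volume < ⊤
  · have hgp : MemLp g p volume := ⟨hg.aestronglyMeasurable, hfin⟩
    have hcoe : ((hgp.toLp _ : Lp F p (volume : Measure E)) : 𝓢'(E, F)) = T := by
      ext θ
      rw [Lp.toTemperedDistribution_apply, hT]
      refine integral_congr_ae ?_
      filter_upwards [hgp.coeFn_toLp] with a ha
      rw [ha]
    rw [← hcoe, eLpNormDistrib_coe, Lp.enorm_def]
    exact eLpNorm_congr_ae hgp.coeFn_toLp
  · rw [not_lt, top_le_iff] at hfin
    rw [hfin]
    refine eLpNormDistrib_of_forall_ne fun f hf => ?_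
    have hpair : ∀ θ : 𝓢(E, ℂ), ∫ x, θ x • (f : E → F) x = ∫ x, θ x • g x := fun θ => by
      rw [← Lp.toTemperedDistribution_apply, hf, hT]
    have hae : (f : E → F) =ᵐ[volume] g := by
      refine ae_eq_of_integral_contDiff_smul_eq ((Lp.memLp f).locallyIntegrable Fact.out) hg
        fun φ hφ hφs => ?_
      have hcs : HasCompactSupport fun y => ((φ y : ℝ) : ℂ) := hφs.comp_left Complex.ofReal_zero
      have hcd : ContDiff ℝ ((⊤ : ℕ∞) : WithTop ℕ∞) fun y => ((φ y : ℝ) : ℂ) :=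
        Complex.ofRealCLM.contDiff.comp hφ
      have h := hpair (hcs.toSchwartzMap hcd)
      have e1 : ∀ v : E → F, (fun x => (hcs.toSchwartzMap hcd) x • v x) = fun x => φ x • v x := by
        intro v
        funext x
        show ((φ x : ℝ) : ℂ) • v x = φ x • v x
        rw [Complex.coe_smul]
      rwa [e1, e1] at h
    have hlt : eLpNorm g p volume < ⊤ := by
      rw [← eLpNorm_congr_ae hae]
      exact (Lp.memLp f).eLpNorm_lt_top
    exact absurd hfin hlt.ne

/-! ## The local splitting -/

/-- **Local frequency splitting** (the local form of Wang–Zhang 2017, Lemma 3.2; see the module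
docstring). Let `f`, `f₁` be locally integrable with `θ • f, θ • f₁ ∈ L¹` for all Schwartz `θ`,
representing the tempered distributions `T`, `T₁`, with `f₁ = f` on `B_{3/2}(x₀)`; let
`2 ≤ p`, `N ∈ ℤ`, `m ∈ ℕ`, and let `A` bound the tails
`∫_{|y-a| ≥ 1/2} |y-a|^{-m} ‖f₁ y - f y‖ dy` for `a ∈ B₁(x₀)`. Then, with `Ψ₀` the Schwartz
representative of the symbol `χ` of `Ṡ₀` and `d = dim E`,
`‖f‖_{L²(B₁(x₀))} ≤ |B₁|^{1/2-1/p} ‖Ṡ_N T‖_{L^p} + ‖T₁ - Ṡ_N T₁‖_{L²} + |B₁|^{1/2} 2^{N(d-m)} p_{m,0}(𝓕Ψ₀) A`.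
[cite: WangZhang2016, Lemma 3.2] -/
theorem eLpNorm_restrict_ball_le_of_lowFreqCutoff {p : ℝ≥0∞} [Fact (1 ≤ p)] (hp : 2 ≤ p)
    {T T₁ : 𝓢'(E, F)} {f f₁ : E → F} (hf : LocallyIntegrable f volume)
    (hf₁ : LocallyIntegrable f₁ volume)
    (hfi : ∀ θ : 𝓢(E, ℂ), Integrable (fun y => θ y • f y))
    (hf₁i : ∀ θ : 𝓢(E, ℂ), Integrable (fun y => θ y • f₁ y))
    (hT : ∀ θ : 𝓢(E, ℂ), T θ = ∫ y, θ y • f y) (hT₁ : ∀ θ : 𝓢(E, ℂ), T₁ θ = ∫ y, θ y • f₁ y)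
    {x₀ : E} (hagree : ∀ y ∈ Metric.ball x₀ (3 / 2), f₁ y = f y) (N : ℤ) (m : ℕ) {A : ℝ≥0∞}
    (hA : ∀ a ∈ Metric.ball x₀ 1,
      ∫⁻ y in (Metric.ball a (1 / 2))ᶜ, ENNReal.ofReal ((‖y - a‖ ^ m)⁻¹) * ‖f₁ y - f y‖ₑ ≤ A) :
    eLpNorm f 2 (volume.restrict (Metric.ball x₀ 1)) ≤
      volume (Metric.ball x₀ 1) ^ (1 / 2 - 1 / p.toReal) * eLpNormDistrib p (lowFreqCutoff N T) +
      eLpNormDistrib 2 (T₁ - lowFreqCutoff N T₁) +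
      volume (Metric.ball x₀ 1) ^ (1 / 2 : ℝ) *
        ENNReal.ofReal ((2 : ℝ) ^ ((N : ℝ) * ((Module.finrank ℝ E : ℝ) - m)) *
          SchwartzMap.seminorm ℂ m 0
            (𝓕 ((hasCompactSupport_lowFreqSymbol (E := E) 0).toSchwartzMap
              (contDiff_lowFreqSymbol 0)))) * A := by
  haveI : Fact ((1 : ℝ≥0∞) ≤ 2) := ⟨by norm_num⟩
  -- Schwartz representatives of the symbols of `Ṡ_N`, `Ṡ_0`
  set Ψ : 𝓢(E, ℂ) := (hasCompactSupport_lowFreqSymbol (E := E) N).toSchwartzMap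
    (contDiff_lowFreqSymbol N) with hΨdef
  set Ψ₀ : 𝓢(E, ℂ) := (hasCompactSupport_lowFreqSymbol (E := E) 0).toSchwartzMap
    (contDiff_lowFreqSymbol 0) with hΨ₀def
  have hΨ : (Ψ : E → ℂ) = lowFreqSymbol N := rfl
  have hΨ₀ : (Ψ₀ : E → ℂ) = lowFreqSymbol 0 := rfl
  -- the continuous representatives of `Ṡ_N T`, `Ṡ_N T₁`
  set G : E → F := fun a => T (SchwartzMap.compSubConstCLM ℂ a (𝓕 Ψ)) with hGdef
  set G₁ : E → F := fun a => T₁ (SchwartzMap.compSubConstCLM ℂ a (𝓕 Ψ)) with hG₁def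
  have hGc : Continuous G := continuous_apply_compSubConstCLM T (𝓕 Ψ)
  have hG₁c : Continuous G₁ := continuous_apply_compSubConstCLM T₁ (𝓕 Ψ)
  set μ : Measure E := volume.restrict (Metric.ball x₀ 1) with hμ
  have hμuniv : μ Set.univ = volume (Metric.ball x₀ 1) := by
    rw [hμ, Measure.restrict_apply_univ]
  -- the decomposition `f = G + (f₁ - G₁) + (G₁ - G)` on the ball
  have hdec : ∀ᵐ y ∂μ, f y = G y + (f₁ y - G₁ y) + (G₁ y - G y) := by
    refine (ae_restrict_mem Metric.isOpen_ball.measurableSet).mono fun y hy => ?_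
    rw [hagree y (Metric.ball_subset_ball (by norm_num) hy)]
    abel
  have hfm : AEStronglyMeasurable f μ := hf.aestronglyMeasurable.restrict
  have hGm : AEStronglyMeasurable G μ := hGc.aestronglyMeasurable
  have h2m : AEStronglyMeasurable (fun y => f₁ y - G₁ y) μ :=
    (hf₁.aestronglyMeasurable.sub hG₁c.aestronglyMeasurable).restrict
  have h3m : AEStronglyMeasurable (fun y => G₁ y - G y) μ := (hG₁c.sub hGc).aestronglyMeasurable
  have hsplit : eLpNorm f 2 μ ≤ eLpNorm G 2 μ + eLpNorm (fun y => f₁ y - G₁ y) 2 μ +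
      eLpNorm (fun y => G₁ y - G y) 2 μ := by
    rw [eLpNorm_congr_ae hdec]
    calc eLpNorm (fun y => G y + (f₁ y - G₁ y) + (G₁ y - G y)) 2 μ
        ≤ eLpNorm (fun y => G y + (f₁ y - G₁ y)) 2 μ + eLpNorm (fun y => G₁ y - G y) 2 μ :=
          eLpNorm_add_le (hGm.add h2m) h3m one_le_two
      _ ≤ eLpNorm G 2 μ + eLpNorm (fun y => f₁ y - G₁ y) 2 μ + eLpNorm (fun y => G₁ y - G y) 2 μ := by
          gcongr
          exact eLpNorm_add_le hGm h2m one_le_two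
  -- term 1: Hölder on the ball and `‖G‖_{L^p} = ‖Ṡ_N T‖_{L^p}`
  have h1 : eLpNorm G 2 μ ≤
      volume (Metric.ball x₀ 1) ^ (1 / 2 - 1 / p.toReal) * eLpNormDistrib p (lowFreqCutoff N T) := by
    have hH := eLpNorm_le_eLpNorm_mul_rpow_measure_univ hp hGm (μ := μ)
    rw [hμuniv, ENNReal.toReal_ofNat] at hH
    refine hH.trans ?_
    rw [mul_comm]
    gcongr
    calc eLpNorm G p μ ≤ eLpNorm G p volume := eLpNorm_mono_measure G Measure.restrict_le_self
      _ = eLpNormDistrib p (lowFreqCutoff N T) := by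
          rw [lowFreqCutoff_apply, ← hΨ, eLpNormDistrib_fourierMultiplierCLM_schwartz_eq]
  -- term 2: `f₁ - G₁` represents `T₁ - Ṡ_N T₁`
  have h2 : eLpNorm (fun y => f₁ y - G₁ y) 2 μ ≤ eLpNormDistrib 2 (T₁ - lowFreqCutoff N T₁) := by
    have hrep : ∀ θ : 𝓢(E, ℂ), (T₁ - lowFreqCutoff N T₁) θ = ∫ y, θ y • (f₁ y - G₁ y) := by
      intro θ
      rw [sub_apply, lowFreqCutoff_apply_eq_integral_of_coe_eq hΨ, hT₁]
      simp_rw [smul_sub]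
      rw [integral_sub (hf₁i θ) (integrable_smul_apply_compSubConstCLM T₁ (𝓕 Ψ) θ)]
    calc eLpNorm (fun y => f₁ y - G₁ y) 2 μ ≤ eLpNorm (fun y => f₁ y - G₁ y) 2 volume :=
          eLpNorm_mono_measure _ Measure.restrict_le_self
      _ = eLpNormDistrib 2 (T₁ - lowFreqCutoff N T₁) :=
          (eLpNormDistrib_eq_eLpNorm_of_forall_apply_eq 2 (hf₁.sub hG₁c.locallyIntegrable) hrep).symm
  -- term 3: off-diagonal decay of `Ṡ_N (T₁ - T)`, represented by `f₁ - f` vanishing on `B_{3/2}(x₀)`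
  set K : ℝ≥0∞ := ENNReal.ofReal ((2 : ℝ) ^ ((N : ℝ) * ((Module.finrank ℝ E : ℝ) - m)) *
    SchwartzMap.seminorm ℂ m 0 (𝓕 Ψ₀)) with hK
  have h3 : eLpNorm (fun y => G₁ y - G y) 2 μ ≤ volume (Metric.ball x₀ 1) ^ (1 / 2 : ℝ) * K * A := by
    have hrep : ∀ θ : 𝓢(E, ℂ), (T₁ - T) θ = ∫ y, θ y • (f₁ y - f y) := by
      intro θ
      rw [sub_apply, hT₁, hT]
      simp_rw [smul_sub]
      rw [integral_sub (hf₁i θ) (hfi θ)]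
    have hpt : ∀ᵐ a ∂μ, ‖G₁ a - G a‖ₑ ≤ K * A := by
      refine (ae_restrict_mem Metric.isOpen_ball.measurableSet).mono fun a ha => ?_
      have hvan : ∀ y ∈ Metric.ball a (1 / 2), f₁ y - f y = 0 := by
        intro y hy
        rw [sub_eq_zero]
        refine hagree y ?_
        rw [Metric.mem_ball] at ha hy ⊢
        calc dist y x₀ ≤ dist y a + dist a x₀ := dist_triangle _ _ _
          _ < 1 / 2 + 1 := add_lt_add hy ha
          _ = 3 / 2 := by norm_num
      have hval : G₁ a - G a = (T₁ - T) (SchwartzMap.compSubConstCLM ℂ a (𝓕 Ψ)) := by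
        rw [sub_apply]
      rw [hval]
      refine (enorm_lowFreqCutoff_value_le_of_eqOn_ball hrep hΨ hΨ₀ (by norm_num) hvan m).trans ?_
      rw [← hK]
      gcongr
      exact hA a ha
    calc eLpNorm (fun y => G₁ y - G y) 2 μ ≤ (K * A) • μ Set.univ ^ (2 : ℝ≥0∞).toReal⁻¹ :=
          eLpNorm_le_of_ae_enorm_bound hpt
      _ = volume (Metric.ball x₀ 1) ^ (1 / 2 : ℝ) * K * A := by
          rw [hμuniv, smul_eq_mul, ENNReal.toReal_ofNat, one_div]
          ring
  calc eLpNorm f 2 μ ≤ eLpNorm G 2 μ + eLpNorm (fun y => f₁ y - G₁ y) 2 μ +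
        eLpNorm (fun y => G₁ y - G y) 2 μ := hsplit
    _ ≤ _ := add_le_add (add_le_add h1 h2) h3

end Literature.Analysis.FunctionSpaces

end
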